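import Summits.AtomisticToContinuum.HydrodynamicLimit.Theses.AntiMazurCoboundaries
import Literature.MathematicalPhysics.KineticTheory.HardSphereEulerProofs
import Literature.Analysis.FluidPDE.HardSphereFlowJointMeasurable
import Summits.AtomisticToContinuum.HydrodynamicLimit.Theorems.JParityClosureOddContactSymmetryGibbsInvariance
import Summits.AtomisticToContinuum.HydrodynamicLimit.Theorems.BoltzmannGreenKubo.Negative.AllWindows
import Summits.AtomisticToContinuum.HydrodynamicLimit.Theorems.BoltzmannGreenKubo.Negative.EnergyFloor

/-!
# Net Lipschitz property of the kinetic-window functional (stub S1 of the line `cutoff-compactness-net`)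

Registered stub `stub_netLipschitz` of the crux `AntiMazurCoboundaries.ShearStressHalfDrude`
(stmt-AtomisticToContinuum-14136): for the homogeneous Gibbs law `G_N = localGibbsLaw σ a u₀ θ N Φ` and
`F_{φ⊗k}(z) = Σᵢ φ(xᵢ) k((vᵢ − u₀)/√θ)`, the Gibbs second moment `V(φ⊗k)` of the kinetic-window average
`h⁻¹∫₀ʰ F_{φ⊗k}∘Φ_s ds` satisfies `V(φ⊗g) ≤ (1+δ)V(φ⊗g') + (1+δ⁻¹)(N+1)∫φ²‖g − g'‖²_γ` for centred bounded
continuous `g, g'`, uniformly in `N, σ ≤ 1/2, Φ, h`. Ingredients: weighted centred statics on a product law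
(`integral_sq_sum_weighted_of_centred`), the UNIFORM ONE-POINT MARGINAL on `(𝕋³)ⁿ` for diagonally
translation-invariant weights (`lintegral_mul_comp_apply`), the EXACT STATIC IDENTITY
`∫ F_{φ⊗k}² dG_N = (N+1)(∫φ²)‖k‖²_γ` (`lintegral_sq_sum_localGibbsMeasure`), Jensen in time + stationarity
(`lintegral_sq_window_le`, after `BoltzmannGreenKubo/Negative/AllWindows`) and the `δ`-Minkowski step
(`lintegral_sq_window_le_of_add`).
-/

noncomputable section

namespace Summit.AtomisticToContinuum.HydrodynamicLimit.Theorems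

open MeasureTheory ProbabilityTheory Filter Set
open scoped ENNReal InnerProductSpace BigOperators
open Literature.Analysis.FluidPDE Literature.MathematicalPhysics.KineticTheory
open BoltzmannGreenKuboOrthMomentum

namespace ShearStressHalfDrudeNetLipschitz

/-! ## Elementary inequalities and weighted centred statics -/

/-- The `δ`-form of `2xy ≤ δx² + δ⁻¹y²`: `(x + y)² ≤ (1 + δ)x² + (1 + δ⁻¹)y²`. [folklore] -/
theorem sq_add_le_delta {δ : ℝ} (hδ : 0 < δ) (x y : ℝ) :
    (x + y) ^ 2 ≤ (1 + δ) * x ^ 2 + (1 + δ⁻¹) * y ^ 2 := by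
  have hδ0 : δ ≠ 0 := hδ.ne'
  have h1 : 0 ≤ δ⁻¹ * (δ * x - y) ^ 2 := by positivity
  have h2 : δ⁻¹ * (δ * x - y) ^ 2 = (1 + δ) * x ^ 2 + (1 + δ⁻¹) * y ^ 2 - (x + y) ^ 2 := by
    field_simp; ring
  linarith

/-- `|Σᵢ cᵢ dᵢ| ≤ n · (C · K)` when `|cᵢ| ≤ C` and `|dᵢ| ≤ K`. [folklore] -/
theorem abs_sum_mul_le {n : ℕ} {c d : Fin n → ℝ} {C K : ℝ} (hc : ∀ i, |c i| ≤ C)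
    (hd : ∀ i, |d i| ≤ K) : |∑ i, c i * d i| ≤ n * (C * K) := by
  refine (Finset.abs_sum_le_sum_abs _ _).trans ?_
  calc ∑ i, |c i * d i| ≤ ∑ _i : Fin n, C * K := Finset.sum_le_sum fun i _ => by
        rw [abs_mul]
        exact mul_le_mul (hc i) (hd i) (abs_nonneg _) ((abs_nonneg _).trans (hc i))
    _ = n * (C * K) := by simp [Finset.sum_const, Finset.card_univ, Fintype.card_fin]

/-- `∫ (Σᵢ cᵢ k(vᵢ))² d(⊗ⁿμ) = (Σᵢ cᵢ²) ∫ k² dμ` for a centred bounded measurable `k`: the cross terms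
vanish by independence (`integral_cross_eq_zero_of_centred`), the diagonal ones are one-particle
integrals (`integral_diag`). [folklore] -/
theorem integral_sq_sum_weighted_of_centred {n : ℕ} (μ : Measure V3) [IsProbabilityMeasure μ]
    {k : V3 → ℝ} (hk : Measurable k) {K : ℝ} (hK : ∀ w, |k w| ≤ K) (hk0 : ∫ w, k w ∂μ = 0)
    (c : Fin n → ℝ) :
    ∫ v, (∑ i, c i * k (v i)) ^ 2 ∂(Measure.pi fun _ : Fin n => μ) =
      (∑ i, c i ^ 2) * ∫ w, k w ^ 2 ∂μ := by
  have hI : ∀ i j : Fin n, Integrable (fun v : Fin n → V3 => c i * k (v i) * (c j * k (v j)))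
      (Measure.pi fun _ : Fin n => μ) := by
    intro i j
    refine (integrable_const (|c i| * K * (|c j| * K))).mono'
      (((measurable_const.mul (hk.comp (measurable_pi_apply i))).mul
        (measurable_const.mul (hk.comp (measurable_pi_apply j)))).aestronglyMeasurable)
      (Eventually.of_forall fun v => ?_)
    rw [Real.norm_eq_abs, abs_mul, abs_mul, abs_mul]
    have hK0 : 0 ≤ K := (abs_nonneg _).trans (hK (v i))
    exact mul_le_mul (mul_le_mul_of_nonneg_left (hK _) (abs_nonneg _))
      (mul_le_mul_of_nonneg_left (hK _) (abs_nonneg _)) (by positivity) (by positivity)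
  have hterm : ∀ i j : Fin n,
      ∫ v, c i * k (v i) * (c j * k (v j)) ∂(Measure.pi fun _ : Fin n => μ) =
        if i = j then c i ^ 2 * ∫ w, k w ^ 2 ∂μ else 0 := by
    intro i j
    have e : (fun v : Fin n → V3 => c i * k (v i) * (c j * k (v j))) =
        fun v => (c i * c j) * (k (v i) * k (v j)) := by
      funext v; ring
    rw [e, integral_const_mul]
    split_ifs with hij
    · subst hij
      rw [show (fun v : Fin n → V3 => k (v i) * k (v i)) = fun v => k (v i) ^ 2 from funext fun v => (sq _).symm,
        integral_diag μ (fun w => k w ^ 2) (hk.pow_const 2) i]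
      ring
    · rw [integral_cross_eq_zero_of_centred μ k k hk hk hk0 hij, mul_zero]
  have e2 : ∀ v : Fin n → V3, (∑ i, c i * k (v i)) ^ 2 = ∑ i, ∑ j, c i * k (v i) * (c j * k (v j)) :=
    fun v => by rw [sq, Finset.sum_mul_sum]
  simp_rw [e2]
  rw [integral_finsetSum _ (fun i _ => integrable_finsetSum _ (fun j _ => hI i j)),
    Finset.sum_congr rfl fun i _ => integral_finsetSum _ (fun j _ => hI i j)]
  simp_rw [hterm, Finset.sum_ite_eq, Finset.mem_univ, if_true, Finset.sum_mul]

/-! ## Uniform one-point marginal on the torus and the exact static identity -/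

/-- **Uniform one-point marginal.** If a weight `ρ` on `(𝕋³)ⁿ` is invariant under the diagonal translations
`x ↦ (t + xⱼ)ⱼ`, then `∫ ρ(x) f(xᵢ) dx = (∫ ρ)(∫ f)`: translate (Haar measure on `(𝕋³)ⁿ` is invariant), average
over `t ∈ 𝕋³` (`vol 𝕋³ = 1`), swap (Tonelli) and use the invariance of `vol` on `𝕋³`. [folklore] -/
theorem lintegral_mul_comp_apply {n : ℕ} {ρ : (Fin n → T3) → ℝ≥0∞} (hρ : Measurable ρ)
    (hinv : ∀ (t : T3) (x : Fin n → T3), ρ (fun j => t + x j) = ρ x)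
    {f : T3 → ℝ≥0∞} (hf : Measurable f) (i : Fin n) :
    ∫⁻ x, ρ x * f (x i) = (∫⁻ x, ρ x) * ∫⁻ y, f y := by
  have hT : ∀ t : T3, MeasurePreserving (fun x : Fin n → T3 => fun j => t + x j) volume volume := fun t => by
    have h : MeasurePreserving (MeasurableEquiv.piCongrRight fun _ : Fin n => MeasurableEquiv.addLeft t)
        (volume : Measure (Fin n → T3)) volume := by
      rw [volume_pi]; exact measurePreserving_pi _ _ fun _ => measurePreserving_add_left volume t
    exact h
  have h1 : ∀ t : T3, ∫⁻ x, ρ x * f (x i) = ∫⁻ x, ρ x * f (t + x i) := fun t => by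
    rw [← (hT t).lintegral_comp (f := fun x : Fin n → T3 => ρ x * f (x i)) (hρ.mul (hf.comp (measurable_pi_apply i)))]
    simp only [hinv]
  have hmeas : AEMeasurable (Function.uncurry fun (t : T3) (x : Fin n → T3) => ρ x * f (t + x i))
      ((volume : Measure T3).prod (volume : Measure (Fin n → T3))) :=
    ((hρ.comp measurable_snd).mul
      (hf.comp (measurable_fst.add ((measurable_pi_apply i).comp measurable_snd)))).aemeasurable
  calc ∫⁻ x, ρ x * f (x i) = ∫⁻ _t : T3, ∫⁻ x, ρ x * f (x i) := by
        rw [lintegral_const, measure_univ, mul_one]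
    _ = ∫⁻ t : T3, ∫⁻ x, ρ x * f (t + x i) := lintegral_congr fun t => h1 t
    _ = ∫⁻ x, ∫⁻ t : T3, ρ x * f (t + x i) := lintegral_lintegral_swap hmeas
    _ = ∫⁻ x, ρ x * ∫⁻ t : T3, f (x i + t) := by
        refine lintegral_congr fun x => ?_
        rw [lintegral_const_mul (ρ x) (f := fun t : T3 => f (t + x i)) (hf.comp (measurable_id.add_const (x i)))]
        simp_rw [add_comm _ (x i)]
    _ = ∫⁻ x, ρ x * ∫⁻ t : T3, f t := by
        simp_rw [lintegral_add_left_eq_self]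
    _ = (∫⁻ x, ρ x) * ∫⁻ y, f y := lintegral_mul_const _ hρ

/-- **Exact static identity**: for continuous `φ`, continuous bounded CENTRED `k`, `σ ≤ 1/2`, `a, θ > 0`, `u₀`,
`∫ (Σᵢ φ(xᵢ) k((vᵢ − u₀)/√θ))² dG_N = (N+1)(∫ φ²) ∫ k² dγ`: given the positions the velocities are i.i.d.
`N(u₀, θ)` (`lintegral_localGibbsMeasure`), so after `v = u₀ + √θ w` the cross terms vanish by centring; the
one-point position marginal is uniform (`lintegral_mul_comp_apply`; the non-overlap constraint only involves
minimal-image distances, which are translation invariant). [folklore] -/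
theorem lintegral_sq_sum_localGibbsMeasure {σ a θ : ℝ} (u₀ : V3) (hσ : σ ≤ 1 / 2) (ha : 0 < a)
    (hθ : 0 < θ) (N : ℕ) {φ : T3 → ℝ} (hφ : Continuous φ) {k : V3 → ℝ} (hk : Continuous k) {K : ℝ}
    (hK : ∀ w, |k w| ≤ K) (hk0 : ∫ w, k w ∂stdGaussian V3 = 0) :
    ∫⁻ z, ENNReal.ofReal ((∑ i, φ (z i).1 * k ((Real.sqrt θ)⁻¹ • ((z i).2 - u₀))) ^ 2)
        ∂(localGibbsMeasure σ (fun _ => a) (fun _ => u₀) (fun _ => θ) N) =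
      ENNReal.ofReal ((((N : ℝ)) + 1) * (∫ x, φ x ^ 2) * ∫ w, k w ^ 2 ∂stdGaussian V3) := by
  haveI : IsProbabilityMeasure (localGibbsMeasure σ (fun _ => a) (fun _ => u₀) (fun _ => θ) N) :=
    isProbabilityMeasure_localGibbsMeasure continuous_const continuous_const continuous_const
      (fun _ => ha) (fun _ => hθ) hσ N
  obtain ⟨Cφ, -, hCφ⟩ := exists_forall_abs_le_of_continuous hφ
  have hsθ : Real.sqrt θ ≠ 0 := (Real.sqrt_pos.2 hθ).ne'
  have hG : Measurable fun z : Config (N + 1) (Fin 3) T3 =>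
      ENNReal.ofReal ((∑ i, φ (z i).1 * k ((Real.sqrt θ)⁻¹ • ((z i).2 - u₀))) ^ 2) := by
    fun_prop
  rw [lintegral_localGibbsMeasure (a₀ := fun _ => a) (θ₀ := fun _ => θ) (u₀ := fun _ => u₀)
    continuous_const continuous_const continuous_const (fun _ => ha.le) (fun _ => hθ) σ N hG]
  -- the velocity integral at fixed positions
  have hinner : ∀ x : Fin (N + 1) → T3,
      ∫⁻ v, ENNReal.ofReal ((∑ i, φ ((zipConfig (x, v) i).1) *
          k ((Real.sqrt θ)⁻¹ • ((zipConfig (x, v) i).2 - u₀))) ^ 2) ∂velMeasure (fun _ => u₀) (fun _ => θ) x =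
        ENNReal.ofReal ((∑ i, φ (x i) ^ 2) * ∫ w, k w ^ 2 ∂stdGaussian V3) := by
    intro x
    simp only [zipConfig_apply]
    rw [show velMeasure (fun _ => u₀) (fun _ => θ) x = Measure.pi fun _ : Fin (N + 1) => gaussMeasure u₀ θ from rfl]
    have hHm : Measurable fun v : Fin (N + 1) → V3 =>
        (∑ i, φ (x i) * k ((Real.sqrt θ)⁻¹ • (v i - u₀))) ^ 2 := by
      fun_prop
    have hHi : Integrable (fun v : Fin (N + 1) → V3 => (∑ i, φ (x i) * k ((Real.sqrt θ)⁻¹ • (v i - u₀))) ^ 2)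
        (Measure.pi fun _ : Fin (N + 1) => gaussMeasure u₀ θ) :=
      (integrable_const ((((N + 1 : ℕ) : ℝ) * (Cφ * K)) ^ 2)).mono' hHm.aestronglyMeasurable
        (Eventually.of_forall fun v => by
          rw [Real.norm_eq_abs, abs_pow]
          exact pow_le_pow_left₀ (abs_nonneg _) (abs_sum_mul_le (fun i => hCφ (x i)) (fun i => hK _)) 2)
    rw [← ofReal_integral_eq_lintegral_ofReal hHi (Eventually.of_forall fun v => sq_nonneg _)]
    congr 1
    -- change of variables `v = u₀ + √θ w`, coordinatewise
    have hS : MeasurePreserving (fun (w : Fin (N + 1) → V3) (i : Fin (N + 1)) => u₀ + Real.sqrt θ • w i)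
        (Measure.pi fun _ : Fin (N + 1) => stdGaussian V3) (Measure.pi fun _ : Fin (N + 1) => gaussMeasure u₀ θ) :=
      measurePreserving_pi (fun _ : Fin (N + 1) => stdGaussian V3) (fun _ : Fin (N + 1) => gaussMeasure u₀ θ)
        (f := fun (_ : Fin (N + 1)) (w : V3) => u₀ + Real.sqrt θ • w)
        (fun _ => ⟨measurable_gaussShift u₀ θ, by rfl⟩)
    rw [← hS.map_eq, integral_map hS.measurable.aemeasurable hHm.aestronglyMeasurable]
    have hcancel : ∀ w : V3, (Real.sqrt θ)⁻¹ • (u₀ + Real.sqrt θ • w - u₀) = w := by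
      intro w
      rw [add_sub_cancel_left, smul_smul, inv_mul_cancel₀ hsθ, one_smul]
    simp only [hcancel]
    exact integral_sq_sum_weighted_of_centred (stdGaussian V3) hk.measurable hK hk0 (fun i => φ (x i))
  simp only [hinner]
  -- the position integral: uniform one-point marginal
  set ρ : (Fin (N + 1) → T3) → ℝ≥0∞ := fun x => ENNReal.ofReal
    ((canonicalPartition (Torus.geometry (Fin 3)) (hsDiameter σ N) (N + 1)
      (localGibbsProfile (fun _ => a) (fun _ => u₀) (fun _ => θ)))⁻¹ *
      posWeight (fun _ => a) (hsDiameter σ N) (N + 1) x) with hρ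
  have hρm : Measurable ρ := (measurable_const.mul (measurable_posWeight continuous_const _ _)).ennreal_ofReal
  have hρ1 : ∫⁻ x, ρ x = 1 :=
    lintegral_posWeight_eq_one (a₀ := fun _ => a) (θ₀ := fun _ => θ) (u₀ := fun _ => u₀)
      continuous_const continuous_const continuous_const (fun _ => ha.le) (fun _ => hθ) σ N
  have hρinv : ∀ (t : T3) (x : Fin (N + 1) → T3), ρ (fun j => t + x j) = ρ x := by
    intro t x
    have hmem : (fun j => t + x j) ∈ posDomain (hsDiameter σ N) (N + 1) ↔ x ∈ posDomain (hsDiameter σ N) (N + 1) := by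
      simp only [posDomain, Set.mem_setOf_eq, Torus.euclidDist_eq, add_sub_add_left_eq_sub]
    simp only [hρ, posWeight]
    by_cases hx : x ∈ posDomain (hsDiameter σ N) (N + 1)
    · rw [Set.indicator_of_mem (hmem.2 hx), Set.indicator_of_mem hx]
    · rw [Set.indicator_of_notMem (mt hmem.1 hx), Set.indicator_of_notMem hx]
  have hf : Measurable fun y : T3 => ENNReal.ofReal (φ y ^ 2) := (hφ.measurable.pow_const 2).ennreal_ofReal
  have hφ2 : ∫⁻ y, ENNReal.ofReal (φ y ^ 2) = ENNReal.ofReal (∫ y, φ y ^ 2) :=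
    (ofReal_integral_eq_lintegral_ofReal (integrable_of_continuous_T3 (hφ.pow 2))
      (Eventually.of_forall fun y => sq_nonneg _)).symm
  have hm : ∀ i : Fin (N + 1), Measurable fun x : Fin (N + 1) → T3 => ρ x * ENNReal.ofReal (φ (x i) ^ 2) :=
    fun i => hρm.mul (hf.comp (measurable_pi_apply i))
  calc ∫⁻ x, ρ x * ENNReal.ofReal ((∑ i, φ (x i) ^ 2) * ∫ w, k w ^ 2 ∂stdGaussian V3)
      = ∫⁻ x, (∑ i, ρ x * ENNReal.ofReal (φ (x i) ^ 2)) * ENNReal.ofReal (∫ w, k w ^ 2 ∂stdGaussian V3) := by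
        refine lintegral_congr fun x => ?_
        rw [ENNReal.ofReal_mul (Finset.sum_nonneg fun i _ => sq_nonneg _),
          ENNReal.ofReal_sum_of_nonneg (fun i _ => sq_nonneg _), ← mul_assoc, Finset.mul_sum]
    _ = (∑ i, ∫⁻ x, ρ x * ENNReal.ofReal (φ (x i) ^ 2)) * ENNReal.ofReal (∫ w, k w ^ 2 ∂stdGaussian V3) := by
        rw [lintegral_mul_const (f := fun x : Fin (N + 1) → T3 => ∑ i, ρ x * ENNReal.ofReal (φ (x i) ^ 2)) _
          (Finset.measurable_sum _ fun i _ => hm i), lintegral_finsetSum _ fun i _ => hm i]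
    _ = (∑ _i : Fin (N + 1), ENNReal.ofReal (∫ y, φ y ^ 2)) * ENNReal.ofReal (∫ w, k w ^ 2 ∂stdGaussian V3) := by
        congr 1
        refine Finset.sum_congr rfl fun i _ => ?_
        rw [lintegral_mul_comp_apply hρm hρinv hf i, hρ1, one_mul, hφ2]
    _ = ENNReal.ofReal ((((N : ℝ)) + 1) * (∫ x, φ x ^ 2) * ∫ w, k w ^ 2 ∂stdGaussian V3) := by
        rw [Finset.sum_const, Finset.card_univ, Fintype.card_fin, nsmul_eq_mul,
          ENNReal.ofReal_mul (mul_nonneg (by positivity) (integral_nonneg fun y => sq_nonneg _)),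
          ENNReal.ofReal_mul (by positivity : (0 : ℝ) ≤ (N : ℝ) + 1)]
        congr 2
        rw [← Nat.cast_succ, ENNReal.ofReal_natCast]

/-! ## Jensen in time + stationarity; linearity of the window average -/

/-- **Window ceiling** (constant profiles `a, θ > 0`, `u₀`, `σ ≤ 1/2`; `lintegral` form): for bounded measurable
`F`, every flow and window `h > 0`, `∫ (h⁻¹∫₀ʰ F(Φ_r z) dr)² dG_N ≤ ∫ F² dG_N` — Jensen in time a.e.
(`sq_avg_le_avg_sq`, sections integrable by `integrable_comp_flow_prod`) and `integral_window_eq`. [folklore] -/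
theorem lintegral_sq_window_le {σ a θ : ℝ} (u₀ : V3) (hσ : σ ≤ 1 / 2) (ha : 0 < a) (hθ : 0 < θ) {N : ℕ}
    (Φ : HardSphereFlow (Torus.geometry (Fin 3)) (hsDiameter σ N) (N + 1))
    {F : Config (N + 1) (Fin 3) T3 → ℝ} (hFm : Measurable F) {C : ℝ} (hFbd : ∀ w, |F w| ≤ C)
    {h : ℝ} (hh : 0 < h) :
    ∫⁻ z, ENNReal.ofReal ((h⁻¹ * ∫ r in (0 : ℝ)..h, F (Φ.flow r z)) ^ 2)
        ∂(localGibbsLaw σ (fun _ => a) (fun _ => u₀) (fun _ => θ) N Φ) ≤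
      ∫⁻ z, ENNReal.ofReal (F z ^ 2) ∂(localGibbsLaw σ (fun _ => a) (fun _ => u₀) (fun _ => θ) N Φ) := by
  haveI : IsProbabilityMeasure (localGibbsLaw σ (fun _ => a) (fun _ => u₀) (fun _ => θ) N Φ) :=
    isProbabilityMeasure_localGibbsLaw continuous_const continuous_const
      continuous_const (fun _ => ha) (fun _ => hθ) hσ N Φ
  have hFi : Integrable F (localGibbsLaw σ (fun _ => a) (fun _ => u₀) (fun _ => θ) N Φ) :=
    (integrable_const C).mono' hFm.aestronglyMeasurable
      (Eventually.of_forall fun w => by rw [Real.norm_eq_abs]; exact hFbd w)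
  have hF2m : Measurable fun w => F w ^ 2 := hFm.pow_const 2
  have hF2i : Integrable (fun w => F w ^ 2) (localGibbsLaw σ (fun _ => a) (fun _ => u₀) (fun _ => θ) N Φ) :=
    (integrable_const (C ^ 2)).mono' hF2m.aestronglyMeasurable
      (Eventually.of_forall fun w => by
        rw [Real.norm_eq_abs, abs_pow]
        exact pow_le_pow_left₀ (abs_nonneg _) (hFbd w) 2)
  -- a.e. `z` the time sections are integrable (product integrability), so Jensen in time applies
  have hsec := (integrable_comp_flow_prod a θ u₀ Φ hFm hFi h).prod_left_ae
  have hsec2 := (integrable_comp_flow_prod a θ u₀ Φ hF2m hF2i h).prod_left_ae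
  have hpt : ∀ᵐ z ∂(localGibbsLaw σ (fun _ => a) (fun _ => u₀) (fun _ => θ) N Φ),
      ENNReal.ofReal ((h⁻¹ * ∫ r in (0 : ℝ)..h, F (Φ.flow r z)) ^ 2) ≤
        ENNReal.ofReal (h⁻¹ * ∫ r in (0 : ℝ)..h, F (Φ.flow r z) ^ 2) := by
    filter_upwards [hsec, hsec2] with z hz hz2
    refine ENNReal.ofReal_le_ofReal (sq_avg_le_avg_sq hh ?_ ?_)
    · rw [intervalIntegrable_iff_integrableOn_Ioc_of_le hh.le]; exact hz
    · rw [intervalIntegrable_iff_integrableOn_Ioc_of_le hh.le]; exact hz2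
  have hwin2 : Integrable (fun z => ∫ r in (0 : ℝ)..h, F (Φ.flow r z) ^ 2)
      (localGibbsLaw σ (fun _ => a) (fun _ => u₀) (fun _ => θ) N Φ) := integrable_window a θ u₀ Φ hF2m hF2i hh.le
  have hnn : ∀ z, 0 ≤ h⁻¹ * ∫ r in (0 : ℝ)..h, F (Φ.flow r z) ^ 2 := fun z =>
    mul_nonneg (inv_nonneg.2 hh.le) (intervalIntegral.integral_nonneg hh.le fun r _ => sq_nonneg _)
  refine (lintegral_mono_ae hpt).trans (le_of_eq ?_)
  rw [← ofReal_integral_eq_lintegral_ofReal (hwin2.const_mul _) (Eventually.of_forall hnn),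
    ← ofReal_integral_eq_lintegral_ofReal hF2i (Eventually.of_forall fun z => sq_nonneg _),
    integral_const_mul, integral_window_eq a θ u₀ Φ (X := fun w => F w ^ 2) hF2m hF2i hh.le, ← mul_assoc,
    inv_mul_cancel₀ hh.ne', one_mul]

/-- **Static ceiling for a modulated centred one-body observable**: the kinetic-window second moment of
`Σᵢ φ(xᵢ) k((vᵢ − u₀)/√θ)` under `G_N` is at most the static one, `= (N+1)(∫φ²)‖k‖²_γ` for centred `k`
(`lintegral_sq_window_le` + `lintegral_sq_sum_localGibbsMeasure`). [folklore] -/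
theorem lintegral_sq_window_oneBody_le {σ a θ : ℝ} (u₀ : V3) (hσ : σ ≤ 1 / 2) (ha : 0 < a) (hθ : 0 < θ)
    {N : ℕ} (Φ : HardSphereFlow (Torus.geometry (Fin 3)) (hsDiameter σ N) (N + 1)) {h : ℝ} (hh : 0 < h)
    {φ : T3 → ℝ} (hφ : Continuous φ) {k : V3 → ℝ} (hk : Continuous k) {K : ℝ} (hK : ∀ v, |k v| ≤ K)
    (hk0 : ∫ v, k v ∂stdGaussian V3 = 0) :
    ∫⁻ z, ENNReal.ofReal ((h⁻¹ * ∫ s in (0 : ℝ)..h,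
        ∑ i, φ (Φ.flow s z i).1 * k ((Real.sqrt θ)⁻¹ • ((Φ.flow s z i).2 - u₀))) ^ 2)
        ∂(localGibbsLaw σ (fun _ => a) (fun _ => u₀) (fun _ => θ) N Φ) ≤
      ENNReal.ofReal ((((N : ℝ)) + 1) * (∫ x, φ x ^ 2) * ∫ v, k v ^ 2 ∂stdGaussian V3) := by
  obtain ⟨Cφ, -, hCφ⟩ := exists_forall_abs_le_of_continuous hφ
  have hFm : Measurable fun z : Config (N + 1) (Fin 3) T3 =>
      ∑ i, φ (z i).1 * k ((Real.sqrt θ)⁻¹ • ((z i).2 - u₀)) := by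
    fun_prop
  have hFbd : ∀ z : Config (N + 1) (Fin 3) T3,
      |∑ i, φ (z i).1 * k ((Real.sqrt θ)⁻¹ • ((z i).2 - u₀))| ≤ ((N + 1 : ℕ) : ℝ) * (Cφ * K) :=
    fun z => abs_sum_mul_le (fun i => hCφ _) (fun i => hK _)
  refine (lintegral_sq_window_le u₀ hσ ha hθ Φ hFm hFbd hh).trans (le_of_eq ?_)
  rw [localGibbsLaw_eq]
  exact lintegral_sq_sum_localGibbsMeasure u₀ hσ ha hθ N hφ hk hK hk0

/-- **The `δ`-form of Minkowski for window averages**: if `F = F₁ + F₂` with `F₁, F₂` bounded measurable, then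
a.e. (where the time sections are integrable) the window average of `F` is the sum of those of `F₁, F₂`, and
`(x+y)² ≤ (1+δ)x² + (1+δ⁻¹)y²` integrates to `∫ A_F² ≤ (1+δ)∫ A_{F₁}² + (1+δ⁻¹)∫ A_{F₂}²`. [folklore] -/
theorem lintegral_sq_window_le_of_add {σ a θ : ℝ} (u₀ : V3) (hσ : σ ≤ 1 / 2) (ha : 0 < a) (hθ : 0 < θ)
    {N : ℕ} (Φ : HardSphereFlow (Torus.geometry (Fin 3)) (hsDiameter σ N) (N + 1))
    {F F₁ F₂ : Config (N + 1) (Fin 3) T3 → ℝ} (hF : ∀ w, F w = F₁ w + F₂ w)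
    (hF₁m : Measurable F₁) (hF₂m : Measurable F₂) {C₁ C₂ : ℝ} (hF₁b : ∀ w, |F₁ w| ≤ C₁)
    (hF₂b : ∀ w, |F₂ w| ≤ C₂) {h : ℝ} (hh : 0 ≤ h) {δ : ℝ} (hδ : 0 < δ) :
    ∫⁻ z, ENNReal.ofReal ((h⁻¹ * ∫ r in (0 : ℝ)..h, F (Φ.flow r z)) ^ 2)
        ∂(localGibbsLaw σ (fun _ => a) (fun _ => u₀) (fun _ => θ) N Φ) ≤
      ENNReal.ofReal (1 + δ) * ∫⁻ z, ENNReal.ofReal ((h⁻¹ * ∫ r in (0 : ℝ)..h, F₁ (Φ.flow r z)) ^ 2)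
        ∂(localGibbsLaw σ (fun _ => a) (fun _ => u₀) (fun _ => θ) N Φ) +
      ENNReal.ofReal (1 + δ⁻¹) * ∫⁻ z, ENNReal.ofReal ((h⁻¹ * ∫ r in (0 : ℝ)..h, F₂ (Φ.flow r z)) ^ 2)
        ∂(localGibbsLaw σ (fun _ => a) (fun _ => u₀) (fun _ => θ) N Φ) := by
  haveI : IsProbabilityMeasure (localGibbsLaw σ (fun _ => a) (fun _ => u₀) (fun _ => θ) N Φ) :=
    isProbabilityMeasure_localGibbsLaw continuous_const continuous_const
      continuous_const (fun _ => ha) (fun _ => hθ) hσ N Φ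
  have hF₁i : Integrable F₁ (localGibbsLaw σ (fun _ => a) (fun _ => u₀) (fun _ => θ) N Φ) :=
    (integrable_const C₁).mono' hF₁m.aestronglyMeasurable
      (Eventually.of_forall fun w => by rw [Real.norm_eq_abs]; exact hF₁b w)
  have hF₂i : Integrable F₂ (localGibbsLaw σ (fun _ => a) (fun _ => u₀) (fun _ => θ) N Φ) :=
    (integrable_const C₂).mono' hF₂m.aestronglyMeasurable
      (Eventually.of_forall fun w => by rw [Real.norm_eq_abs]; exact hF₂b w)
  have hsec₁ := (integrable_comp_flow_prod a θ u₀ Φ hF₁m hF₁i h).prod_left_ae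
  have hsec₂ := (integrable_comp_flow_prod a θ u₀ Φ hF₂m hF₂i h).prod_left_ae
  have hA₂m : AEMeasurable (fun z => ENNReal.ofReal ((h⁻¹ * ∫ r in (0 : ℝ)..h, F₂ (Φ.flow r z)) ^ 2))
      (localGibbsLaw σ (fun _ => a) (fun _ => u₀) (fun _ => θ) N Φ) :=
    (((Φ.aemeasurable_intervalIntegral_comp_flow_torus hF₂m 0 h
      (localGibbsLaw_compl_good a θ u₀ Φ)).const_mul h⁻¹).pow_const 2).ennreal_ofReal
  have hpt : ∀ᵐ z ∂(localGibbsLaw σ (fun _ => a) (fun _ => u₀) (fun _ => θ) N Φ),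
      ENNReal.ofReal ((h⁻¹ * ∫ r in (0 : ℝ)..h, F (Φ.flow r z)) ^ 2) ≤
        ENNReal.ofReal (1 + δ) * ENNReal.ofReal ((h⁻¹ * ∫ r in (0 : ℝ)..h, F₁ (Φ.flow r z)) ^ 2) +
        ENNReal.ofReal (1 + δ⁻¹) * ENNReal.ofReal ((h⁻¹ * ∫ r in (0 : ℝ)..h, F₂ (Φ.flow r z)) ^ 2) := by
    filter_upwards [hsec₁, hsec₂] with z hz₁ hz₂
    simp only [hF]
    rw [intervalIntegral.integral_add ((intervalIntegrable_iff_integrableOn_Ioc_of_le hh).2 hz₁)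
      ((intervalIntegrable_iff_integrableOn_Ioc_of_le hh).2 hz₂), mul_add,
      ← ENNReal.ofReal_mul (by positivity : (0 : ℝ) ≤ 1 + δ), ← ENNReal.ofReal_mul (by positivity : (0 : ℝ) ≤ 1 + δ⁻¹),
      ← ENNReal.ofReal_add (by positivity) (by positivity)]
    exact ENNReal.ofReal_le_ofReal (sq_add_le_delta hδ _ _)
  refine (lintegral_mono_ae hpt).trans (le_of_eq ?_)
  rw [lintegral_add_right' _ (hA₂m.const_mul _), lintegral_const_mul' _ _ ENNReal.ofReal_ne_top,
    lintegral_const_mul' _ _ ENNReal.ofReal_ne_top]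

/-! ## The stub -/

/-- **S1 — NET LIPSCHITZ** (registered stub of the line `cutoff-compactness-net`, crux
`AntiMazurCoboundaries.ShearStressHalfDrude`, stmt-AtomisticToContinuum-14136): for centred bounded continuous
`g, g'`, continuous `φ`, `h > 0`, `N`, `0 < σ ≤ 1/2`, any flow `Φ` and `δ > 0`,
`V(φ⊗g) ≤ (1+δ)·V(φ⊗g') + (1+δ⁻¹)·(N+1)·∫φ²·‖g − g'‖²_{L²(γ)}`: `F_{φ⊗g} = F_{φ⊗g'} + F_{φ⊗(g−g')}`, the window
average is linear a.e. and `(x+y)² ≤ (1+δ)x² + (1+δ⁻¹)y²` (`lintegral_sq_window_le_of_add`); the last window second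
moment is at most the static one, EXACTLY `(N+1)(∫φ²)‖g − g'‖²_γ` (`lintegral_sq_window_oneBody_le`). [folklore] -/
theorem stub_netLipschitz :
    ∀ (σ a θ : ℝ) (u₀ : V3), 0 < σ → σ ≤ 1 / 2 → 0 < a → 0 < θ →
    ∀ (N : ℕ) (Φ : HardSphereFlow (Torus.geometry (Fin 3)) (hsDiameter σ N) (N + 1)) (h : ℝ), 0 < h →
    ∀ (φ : T3 → ℝ) (g g' : V3 → ℝ), Continuous φ → Continuous g → Continuous g' →
      (∃ K : ℝ, ∀ v, |g v| ≤ K) → (∃ K : ℝ, ∀ v, |g' v| ≤ K) →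
      ∫ v, g v ∂stdGaussian V3 = 0 → ∫ v, g' v ∂stdGaussian V3 = 0 →
    ∀ δ : ℝ, 0 < δ →
      ∫⁻ z, ENNReal.ofReal ((h⁻¹ * ∫ s in (0 : ℝ)..h,
          ∑ i, φ (Φ.flow s z i).1 * g ((Real.sqrt θ)⁻¹ • ((Φ.flow s z i).2 - u₀))) ^ 2)
        ∂(localGibbsLaw σ (fun _ => a) (fun _ => u₀) (fun _ => θ) N Φ) ≤
      ENNReal.ofReal (1 + δ) *
        ∫⁻ z, ENNReal.ofReal ((h⁻¹ * ∫ s in (0 : ℝ)..h,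
          ∑ i, φ (Φ.flow s z i).1 * g' ((Real.sqrt θ)⁻¹ • ((Φ.flow s z i).2 - u₀))) ^ 2)
        ∂(localGibbsLaw σ (fun _ => a) (fun _ => u₀) (fun _ => θ) N Φ) +
      ENNReal.ofReal ((1 + δ⁻¹) * (((N : ℝ)) + 1) * (∫ x, φ x ^ 2) *
        ∫ v, (g v - g' v) ^ 2 ∂stdGaussian V3) := by
  intro σ a θ u₀ _hσp hσ ha hθ N Φ h hh φ g g' hφ hg hg' hgb hg'b hg0 hg'0 δ hδ
  obtain ⟨Kg, hKg⟩ := hgb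
  obtain ⟨Kg', hKg'⟩ := hg'b
  obtain ⟨Cφ, -, hCφ⟩ := exists_forall_abs_le_of_continuous hφ
  -- `F_{φ⊗g} = F_{φ⊗g'} + F_{φ⊗(g−g')}`
  have hF : ∀ w : Config (N + 1) (Fin 3) T3,
      (∑ i, φ (w i).1 * g ((Real.sqrt θ)⁻¹ • ((w i).2 - u₀))) =
        (∑ i, φ (w i).1 * g' ((Real.sqrt θ)⁻¹ • ((w i).2 - u₀))) +
        ∑ i, φ (w i).1 * (g ((Real.sqrt θ)⁻¹ • ((w i).2 - u₀)) - g' ((Real.sqrt θ)⁻¹ • ((w i).2 - u₀))) :=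
    fun w => by rw [← Finset.sum_add_distrib]; exact Finset.sum_congr rfl fun i _ => by ring
  have h₁m : Measurable fun w : Config (N + 1) (Fin 3) T3 =>
      ∑ i, φ (w i).1 * g' ((Real.sqrt θ)⁻¹ • ((w i).2 - u₀)) := by
    fun_prop
  have h₂m : Measurable fun w : Config (N + 1) (Fin 3) T3 =>
      ∑ i, φ (w i).1 * (g ((Real.sqrt θ)⁻¹ • ((w i).2 - u₀)) - g' ((Real.sqrt θ)⁻¹ • ((w i).2 - u₀))) := by
    fun_prop
  have hdb : ∀ v, |g v - g' v| ≤ Kg + Kg' := fun v => (abs_sub _ _).trans (add_le_add (hKg v) (hKg' v))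
  have h₁b := fun w : Config (N + 1) (Fin 3) T3 =>
    abs_sum_mul_le (fun i => hCφ (w i).1) (fun i => hKg' ((Real.sqrt θ)⁻¹ • ((w i).2 - u₀)))
  have h₂b := fun w : Config (N + 1) (Fin 3) T3 =>
    abs_sum_mul_le (fun i => hCφ (w i).1) (fun i => hdb ((Real.sqrt θ)⁻¹ • ((w i).2 - u₀)))
  -- `g − g'` is centred
  have hgi : Integrable g (stdGaussian V3) := (integrable_const Kg).mono' hg.measurable.aestronglyMeasurable
    (Eventually.of_forall fun v => by rw [Real.norm_eq_abs]; exact hKg v)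
  have hg'i : Integrable g' (stdGaussian V3) := (integrable_const Kg').mono' hg'.measurable.aestronglyMeasurable
    (Eventually.of_forall fun v => by rw [Real.norm_eq_abs]; exact hKg' v)
  have hd0 : ∫ v, (g v - g' v) ∂stdGaussian V3 = 0 := by
    rw [integral_sub hgi hg'i, hg0, hg'0, sub_zero]
  have step1 := lintegral_sq_window_le_of_add u₀ hσ ha hθ Φ hF h₁m h₂m h₁b h₂b hh.le hδ
  have step2 := lintegral_sq_window_oneBody_le u₀ hσ ha hθ Φ hh hφ (k := fun v => g v - g' v)
    (hg.sub hg') hdb hd0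
  refine step1.trans ?_
  refine (add_le_add_right (mul_le_mul_right step2 _) _).trans (le_of_eq ?_)
  congr 1
  rw [← ENNReal.ofReal_mul (by positivity : (0 : ℝ) ≤ 1 + δ⁻¹)]
  congr 1
  ring

end ShearStressHalfDrudeNetLipschitz

end Summit.AtomisticToContinuum.HydrodynamicLimit.Theorems

end
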